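import Literature.AnabelianGeometry.AbsoluteAnabelian.AbsTopIII.BiAnabelianCompatibilityTeleDeltaShift
import Literature.AnabelianGeometry.AbsoluteAnabelian.AbsTopIII.BiAnabelianLogGlueTelecore
import Literature.AnabelianGeometry.AbsoluteAnabelian.PseudoShadowInvariance

/-!
# [AbsTopIII] Cor. 3.7 (v), final sentence — `Φ_m` IS compatible with the canonical shadow family `K'`
# (second conjunct of `ShiftCompatStmt′ θ`, UNCONDITIONALLY)

[cite: MochizukiAbsTopIII2015, Cor 3.7 (v) p.88]

abc-iut-L4-t5 (gen 7), residual (R2) of HOME/staging/L4/L4-t5/DISCHARGE-PLAN-Cor37-compat.md §UPDATE gen 6.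
Print, (v) l. 52–54: "the self-equivalences in these nexus-classes are compatible with `ℋ_δ` [cf. (ii)], as well as
with the families of homotopies that constitute the cores, telecore, and observable of (i), (ii), (iii)".  The
family `K' := (deltaShadow θ).shadowFamily (deltaFF θ)` (abc-iut-L4-t12's canonical family of the pseudo-commuting
shadow of `𝒟*` determined by `θ^bi`) realises the telecore `𝔗_δ` AND `ℋ_δ` for every setting
(`realisesTeleDelta_shadowFamily`, gen 6).  Here: abc-iut-L4-t12's nexus self-equivalence `Φ_m = shiftEquiv m` is
Def. 3.5 (v)-compatible with `K'` for every setting, every `θ^bi` and every `m` — the homotopy half of the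
invariance (`shadowFamily_η_shift_heq`: the shadow `deltaShadow θ` is LITERALLY translation-invariant,
`deltaShadow_comapAlong_shift_heq`, so the universal homotopies of a translated pair are those of the pair, by the
generic `PseudoShadow.shadowFamily_η_mapPath_heq`) on top of gen 6's boundary half `shadowFamily_E_shift_iff`, fed
to abc-iut-w6-d023's `OneMorphism.nonempty_compatibleWith_of_invariant`.  Consequences:

* `compatibleWith_shiftEquiv_shadowFamily θ m` — `Φ_m` is compatible with `K'`;
* `shiftCompatStmt'_teleDelta θ` — the SECOND conjunct of the successor statement `ShiftCompatStmt′ θ` holds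
  outright (with `Φ = shiftEquiv`, the `ℤ`-action of (v), `isShiftAction_shiftEquiv`);
* `shiftCompatStmt'_of_glueFamily_le'` — `ShiftCompatStmt′ θ` from ANY `Φ_m`-invariant family `K ⊇ K₁` realising
  `𝔖†_log`: gen 6's `shiftCompatStmt'_of_glueFamily_le` with its `K'`-hypothesis discharged;
* `shiftCompatStmt'_of_iotaOverGal_of_shiftInvariant` — the instance at abc-iut-w5-d053's glued family
  `K₂ = glueLogFamily hT hL` (row «COR37-LOGOBS-GLUE», `BiAnabelianLogGlueFamily`, under the `ι`-over-Galois
  hypotheses (H×), (Hlog); it realises the whole (iii) collection, abc-iut-w5-d053's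
  `realisesCoresLogObsTele_glueLogFamily`): `ShiftCompatStmt′ θ` follows from the ONE remaining named input, the
  `Φ_m`-invariance of `K₂`.

Proof-only; model-level bookkeeping over the abstract `BiAnabelianSetting`; refereed pre-IUT material; nothing here
bears on [IUTchIII] Cor. 3.12.
-/

set_option autoImplicit false

namespace Literature.AnabelianGeometry.AbsoluteAnabelian

open _root_.CategoryTheory _root_.Quiver

universe u

namespace AbsTopIII.BiAnabelianSetting

open DiagramOfCategories

variable {X E N : Type u} [Category.{u} X] [Category.{u} E] [Category.{u} N]
  (𝔖 : BiAnabelianSetting X E N) (θ : FiberSquare.BiAnabelianLift 𝔖.gal)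

/-! ## The shadow of `𝒟*` is translation-invariant -/

/-- The edge shadows are translation-invariant. [cite: MochizukiAbsTopIII2015, Cor 3.7 (v) p.88] -/
theorem deltaShe_shiftHom_heq (m : ℤ) {a b : Cor37Vertex} (e : a ⟶ b) :
    HEq ((𝔖.deltaShadow θ).she (Cor37Vertex.shiftHom m e)) ((𝔖.deltaShadow θ).she e) := by
  cases e <;> exact HEq.rfl

/-- **`(shift m)^*(deltaShadow θ) ≍ deltaShadow θ`**: the pseudo-commuting shadow of `𝒟*` determined by `θ^bi`
(shadow categories `𝒳`/`𝒩`/`𝔈`, augmentations `π_𝒳`/identities, edge shadows, edge 2-cells — `θ^bi` over every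
`pr_⋎`) does not see the row index. [cite: MochizukiAbsTopIII2015, Cor 3.7 (v) p.88] -/
theorem deltaShadow_comapAlong_shift_heq (m : ℤ) :
    HEq ((𝔖.deltaShadow θ).comapAlong (Cor37Vertex.shift.{u, u} m)) (𝔖.deltaShadow θ) :=
  PseudoShadow.heq_of_eq (𝔖.comapAlong_shift m) (fun a => 𝔖.deltaSh_shiftObj θ m a)
    (fun a => 𝔖.deltaAug_shiftObj_heq θ m a) (fun _ _ e => 𝔖.deltaShe_shiftHom_heq θ m e)
    (fun _ _ e => 𝔖.deltaCan_shiftHom_heq θ m e)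

/-- The full-faithfulness witnesses of the augmentations do not see the row index.
[cite: MochizukiAbsTopIII2015, Cor 3.7 (v) p.88] -/
theorem deltaFF_shiftObj_heq (m : ℤ) (b : Cor37Vertex) :
    HEq (𝔖.deltaFF θ (Cor37Vertex.shiftObj m b)) (𝔖.deltaFF θ b) := by
  cases b <;> exact HEq.rfl

/-! ## The homotopies of `K'` are translation-invariant -/

/-- **The universal homotopy of a translated pair IS the universal homotopy of the pair** (heterogeneously):
the homotopy half of the Def. 3.5 (v) compatibility of `Φ_m` with `K'`.
[cite: MochizukiAbsTopIII2015, Cor 3.7 (v) p.88] -/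
theorem shadowFamily_η_shift_heq (m : ℤ) {a b : Cor37Vertex} {P Q : Path a b}
    (h : ((𝔖.deltaShadow θ).shadowFamily (𝔖.deltaFF θ)).E P Q)
    (h' : ((𝔖.deltaShadow θ).shadowFamily (𝔖.deltaFF θ)).E ((Cor37Vertex.shift.{u, u} m).mapPath P)
      ((Cor37Vertex.shift.{u, u} m).mapPath Q)) :
    HEq (((𝔖.deltaShadow θ).shadowFamily (𝔖.deltaFF θ)).η h')
      (((𝔖.deltaShadow θ).shadowFamily (𝔖.deltaFF θ)).η h) :=
  (𝔖.deltaShadow θ).shadowFamily_η_mapPath_heq (𝔖.deltaFF θ) (Cor37Vertex.shift.{u, u} m)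
    (𝔖.comapAlong_shift m) (𝔖.deltaShadow_comapAlong_shift_heq θ m)
    (fun b => 𝔖.deltaFF_shiftObj_heq θ m b) h h'

/-! ## `Φ_m` is compatible with `K'` -/

/-- **[AbsTopIII] Cor. 3.7 (v), final sentence, `𝔗_δ`/`ℋ_δ` PART — PROVED for every setting**: the nexus
self-equivalence `Φ_m` (abc-iut-L4-t12's `shiftEquiv m`) is compatible, in the sense of Def. 3.5 (v), with the
canonical shadow family `K'` — the family realising the telecore `𝔗_δ` and `ℋ_δ` of (ii)
(`realisesTeleDelta_shadowFamily`). [cite: MochizukiAbsTopIII2015, Cor 3.7 (v) p.88] -/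
theorem compatibleWith_shiftEquiv_shadowFamily (m : ℤ) :
    Nonempty ((𝔖.shiftEquiv m).hom.CompatibleWith ((𝔖.deltaShadow θ).shadowFamily (𝔖.deltaFF θ))
      ((𝔖.deltaShadow θ).shadowFamily (𝔖.deltaFF θ))) :=
  OneMorphism.nonempty_compatibleWith_of_invariant (𝔖.shiftMor m) (𝔖.comapAlong_shift m)
    (𝔖.shiftApp_heq_id m) (𝔖.shiftMor_iso_app m)
    (fun _ _ p' => Prefunctor.exists_mapPath_eq_of_inverse (Cor37Vertex.shift_comp_neg m)
      (Cor37Vertex.shift_neg_comp m) p')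
    _ _ (fun _ _ P Q => 𝔖.shadowFamily_E_shift_iff θ m P Q)
    (fun _ _ _ _ h => 𝔖.shadowFamily_η_shift_heq θ m h _)

/-- **The second conjunct of the successor statement `ShiftCompatStmt′ θ` holds outright** (every setting, every
`θ^bi`): a family realising `𝔗_δ` with `ℋ_δ` that is compatible with every `Φ_m` of the `ℤ`-action of (v).
[cite: MochizukiAbsTopIII2015, Cor 3.7 (v) p.88] -/
theorem shiftCompatStmt'_teleDelta :
    𝔖.IsShiftAction 𝔖.shiftEquiv ∧
      ∃ K' : 𝔖.starDiagram.HomotopyFamily,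
        𝔖.RealisesTeleDelta θ K' ∧ ∀ m : ℤ, Nonempty ((𝔖.shiftEquiv m).hom.CompatibleWith K' K') :=
  ⟨𝔖.isShiftAction_shiftEquiv, _, 𝔖.realisesTeleDelta_shadowFamily θ,
    fun m => 𝔖.compatibleWith_shiftEquiv_shadowFamily θ m⟩

/-- **Cor. 3.7 (v), final sentence (successor `ShiftCompatStmt′ θ`) from a `Φ_m`-invariant family `K ⊇ K₁`
realising `𝔖†_log`** (the intended instance is abc-iut-w5-d053's glue family `K₂` under the `ι`-over-Galois
hypotheses): gen 6's `shiftCompatStmt'_of_glueFamily_le` with its `K'`-hypothesis DISCHARGED.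
[cite: MochizukiAbsTopIII2015, Cor 3.7 (v) p.88] -/
theorem shiftCompatStmt'_of_glueFamily_le' (K : 𝔖.starDiagram.HomotopyFamily)
    (hK : ∀ ⦃a b : Cor37Vertex⦄ ⦃P Q : Path a b⦄ (h : 𝔖.glueFamily.E P Q), ∃ h' : K.E P Q,
      𝔖.glueFamily.η h = K.η h')
    (hobs : ∃ H : 𝔖.logObsDiagram.HomotopyFamily, 𝔖.IsLogObservableFamily H ∧ H.CompatibleAlong embLog K)
    (hKshift : ∀ m : ℤ, Nonempty ((𝔖.shiftEquiv m).hom.CompatibleWith K K)) :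
    𝔖.ShiftCompatStmt' θ :=
  𝔖.shiftCompatStmt'_of_glueFamily_le θ K hK hobs hKshift (fun m => 𝔖.compatibleWith_shiftEquiv_shadowFamily θ m)

/-- The same from a family realising the whole (iii) collection (`RealisesCoresLogObsTele K`) and
`Φ_m`-invariant — the literal shape of the first conjunct. [cite: MochizukiAbsTopIII2015, Cor 3.7 (v) p.88] -/
theorem shiftCompatStmt'_of_realises (K : 𝔖.starDiagram.HomotopyFamily) (hK : 𝔖.RealisesCoresLogObsTele K)
    (hKshift : ∀ m : ℤ, Nonempty ((𝔖.shiftEquiv m).hom.CompatibleWith K K)) : 𝔖.ShiftCompatStmt' θ :=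
  ⟨𝔖.shiftEquiv, 𝔖.isShiftAction_shiftEquiv, ⟨K, hK, hKshift⟩,
    ⟨_, 𝔖.realisesTeleDelta_shadowFamily θ, fun m => 𝔖.compatibleWith_shiftEquiv_shadowFamily θ m⟩⟩

/-- **What holds UNCONDITIONALLY of `ShiftCompatStmt′ θ`, as a record** (every setting, every `θ^bi`): the
`ℤ`-action, the `Φ_m`-compatibility of the glue family `K₁` (which realises the (iii) collection EXCEPT
`𝔖†_log`: the three cores and the telecore family `𝒥`), and the full second conjunct.  The only named residual is
the `𝔖†_log` constituent of the first family (abc-iut-w5-d053's `K₂` under (H×), (Hlog)).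
[cite: MochizukiAbsTopIII2015, Cor 3.7 (v) p.88] -/
theorem shiftCompatStmt'_unconditional_part :
    𝔖.IsShiftAction 𝔖.shiftEquiv ∧
      (∀ m : ℤ, Nonempty ((𝔖.shiftEquiv m).hom.CompatibleWith 𝔖.glueFamily 𝔖.glueFamily)) ∧
      (∃ H₁ hH₁ hc, ∃ T : (𝔖.daggerLe 1).Telecore (𝔖.refCoreObs H₁ hH₁) hc,
        𝔖.IsTelecoreDelta T ∧ T.Jfam.CompatibleAlong (embTele T) 𝔖.glueFamily) ∧
      (∃ K' : 𝔖.starDiagram.HomotopyFamily,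
        𝔖.RealisesTeleDelta θ K' ∧ ∀ m : ℤ, Nonempty ((𝔖.shiftEquiv m).hom.CompatibleWith K' K')) :=
  ⟨𝔖.isShiftAction_shiftEquiv, 𝔖.compatibleWith_shiftEquiv_glueFamily, (𝔖.shiftCompat_partial θ).2.2.1,
    (𝔖.shiftCompatStmt'_teleDelta θ).2⟩


/-! ## At abc-iut-w5-d053's glued family `K₂` -/

section IotaOverGal

variable (hT : ∀ y : X, 𝔖.spaceGal.map (𝔖.iotaTimes.app y) = 𝔖.lamTimesGal.hom.app y ≫ 𝔖.lamTimesPfGal.inv.app y)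
  (hL : ∀ A : X, 𝔖.spaceGal.map (𝔖.iotaLog.app A) =
    𝔖.lamTimesGal.hom.app (𝔖.log.obj A) ≫ 𝔖.logGal.hom.app A ≫ 𝔖.lamTimesPfGal.inv.app A)

/-- **Cor. 3.7 (v), final sentence (successor `ShiftCompatStmt′ θ`) under (H×), (Hlog), from the ONE remaining
named input** — the `Φ_m`-invariance of abc-iut-w5-d053's glued family `K₂ = glueLogFamily hT hL` (Def. 3.5 (v)
compatibility of `shiftEquiv m` with `K₂`); the second family `K'` and its `Φ_m`-compatibility are supplied here.
[cite: MochizukiAbsTopIII2015, Cor 3.7 (v) p.88] -/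
theorem shiftCompatStmt'_of_iotaOverGal_of_shiftInvariant
    (hKshift : ∀ m : ℤ, Nonempty ((𝔖.shiftEquiv m).hom.CompatibleWith (𝔖.glueLogFamily hT hL)
      (𝔖.glueLogFamily hT hL))) :
    𝔖.ShiftCompatStmt' θ :=
  𝔖.shiftCompatStmt'_of_realises θ (𝔖.glueLogFamily hT hL) (𝔖.realisesCoresLogObsTele_glueLogFamily θ hT hL)
    hKshift

end IotaOverGal

end AbsTopIII.BiAnabelianSetting

end Literature.AnabelianGeometry.AbsoluteAnabelian
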